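import Summits.HodgeConjecture.HodgeConjecture.Theorems.F0P6aSpecOrgansBlockC
import HarnessLib

/-!
# `F0P6aSpecOrgansBlockI` — ★ RE-HOME of `Lines/F0_P6a_SpecOrgans.lean` (tree sha16 f8c3b4bc8f4404ac, 1249 l.), PART 2 of 5 — tree lines :379–:610
See PART 1 `Theorems/F0P6aSpecOrgansBlockC.lean` for the full ★ re-home header and the original module docstring (verbatim there).  Same namespace (every
fully-qualified name unchanged); the scopes open at the cut are re-opened below with their `variable` ∕ `open` ∕ `set_option` ∕ `universe` lines replayed verbatim
from the tree, in order; the code after the replay block is the tree bytes :379–:610, untouched except the (d1) cure named in PART 1.  HC_CM is proved only modulo the 7 printed citations (2 remaining: hLiu418 = stmt-HodgeConjecture-24832, h413 = stmt-HodgeConjecture-24833) until rung 0 closes; a re-home is count-neutral.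
-/

-- ── replay of the scopes open at tree line :379 (verbatim) ──
set_option autoImplicit false
set_option linter.dupNamespace false
noncomputable section
universe u
namespace Summit.HodgeConjecture.HodgeConjecture.Cruxes.HLiu418.F0P6aLineSpecialisation

/-! ## §I — (C6′) PACK — LA2-p04 (g2) `QuotWDFold.v1` 7115abd15a66e5a8 (§1 LA6-p01 (g2) glue 8d9e7e99 + §1b `rosati_baseChange₀` + §2, byte-identical; file-level `backward.isDefEq.respectTransparency false` re-scoped to this block) -/

section Block_I

open CategoryTheory CategoryTheory.Limits AlgebraicGeometry MonoidalCategory CartesianMonoidalCategory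
set_option backward.isDefEq.respectTransparency false
open scoped MonObj
open Literature.AlgebraicGeometry.Motives Literature.AlgebraicGeometry.GroupSchemes Literature.AlgebraicGeometry.GroupSchemes.GroupSchemeKernel
open Literature.AlgebraicGeometry.GroupSchemes.AffineGroupScheme Literature.AlgebraicGeometry.GroupSchemes.TorsionLayer

section Rosati

open Literature.AlgebraicGeometry.AbelianSchemes Literature.AlgebraicGeometry.AbelianSchemes.AbelianSchemeOver

/-- **The Rosati law of a ring action base-changes** along any `g : S′ ⟶ S`: from `ι(star a) ≫ λ = λ ≫ ι(a)^∨` over `S` to the same law for ★ `act₀.baseChange g`,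
`baseChangeHom λ g` and ★ `D₀.baseChange g` (★ `DualPair.baseChangeHom_dualIsogenyOver_base`). [cite: MumfordFogartyKirwan1994, Ch. 6 §1 Cor. 6.8 (p. 118)]
[cite: Kottwitz1992, §5 (pp. 389–391)] -/
theorem rosati_baseChange₀ {S S' : Scheme.{u}} (g : S' ⟶ S) {A₀ : AbelianSchemeOver S} {O : Type*} [CommRing O]
    (act₀ : A₀.RingAction O) (D₀ : A₀.DualPair) (lam : A₀.X ⟶ D₀.hat.X) (star : O → O)
    (hRos : ∀ a, haveI := act₀.isMonHom_i a
      act₀.i (star a) ≫ lam = lam ≫ DualPair.dualIsogenyOver (act₀.i a) D₀ D₀) (a : O) :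
    haveI := (act₀.baseChange g).isMonHom_i a
    (act₀.baseChange g).i (star a) ≫ baseChangeHom lam g =
      baseChangeHom lam g ≫ DualPair.dualIsogenyOver ((act₀.baseChange g).i a) (D₀.baseChange g) (D₀.baseChange g) := by
  haveI := act₀.isMonHom_i a
  have h := congrArg (fun f => (Over.pullback g).map f) (hRos a)
  simp only [Functor.map_comp] at h
  change baseChangeHom (act₀.i (star a)) g ≫ baseChangeHom lam g =
    baseChangeHom lam g ≫ baseChangeHom (A := D₀.hat) (B := D₀.hat) (DualPair.dualIsogenyOver (act₀.i a) D₀ D₀) g at h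
  rw [DualPair.baseChangeHom_dualIsogenyOver_base g (act₀.i a) D₀ D₀] at h
  exact h

end Rosati

section QuotWDFold

open NumberField IsDedekindDomain MulAction
open scoped Matrix Pointwise
open Literature.NumberTheory.Automorphic Literature.NumberTheory.Automorphic.UnitaryGroup
open Literature.AlgebraicGeometry.ShimuraVarieties.UnitaryCanonicalModel
open Literature.NumberTheory.Automorphic.Liu2021.AppendixC
open Literature.AlgebraicGeometry.Motives (AlgPoints IntegralModel SchemeOver thickening thickeningGalAction thickeningLift specOver)
open Literature.NumberTheory.DiophantineGeometry (geomResidueField specialFibreFunctor specResidueField)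
open Literature.AlgebraicGeometry.RelativeSpec (ActionOver)
open Literature.AlgebraicGeometry.AbelianSchemes Literature.AlgebraicGeometry.AbelianSchemes.AbelianSchemeOver
open Summit.HodgeConjecture.HodgeConjecture.Cruxes.HLiu418.F0P6aModuliDatumDefs
open Summit.HodgeConjecture.HodgeConjecture.Cruxes.HLiu418.F0P6aRGDAssembly
open Summit.HodgeConjecture.HodgeConjecture.Cruxes.HLiu418.F0P6aDatumOfInputs

-- the frame of the D-line՚s `Letters` section VERBATIM
variable {F : Type} [Field F] [NumberField F] [IsCMField F] {ι₁ : F →+* ℂ}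
    {Jstar : Matrix (Fin 2) (Fin 2) F}
    {K₀ : C5.OpenCompactSubgroup ↥(finAdelic ↥(maximalRealSubfield F) F (IsCMField.complexConj F) 2 Jstar)}
    {S : RecordSystemGS F Jstar ι₁ K₀} {hU7ₛ : S.HeckeTranslateDefinedOver}
    {hJ : (Jstar.map (IsCMField.complexConj F))ᵀ = Jstar} {hJu : IsUnit Jstar}
    {Fi : Type} [Field Fi] [Algebra F Fi] {Kc : C5.SmallLevel K₀} {G : Type} [Group G]
    {𝓜 : IntegralModel (𝓞 F) F ((thickening F Fi).obj (S.M.obj Kc))}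
    {w : HeightOneSpectrum (𝓞 F)} {hw : (IsCMField.complexConj F) • w ≠ w} {h𝓨 : (𝓜.localise w).IsSmoothProper 1}
    {θ : ActionOver (𝓜.localise w).total.hom ((Fi ≃ₐ[F] Fi) × G)}
    {e : Fi →ₐ[F] AlgebraicClosure (w.adicCompletion F)}

set_option maxHeartbeats 400000 in
/-- **(s-LAG) AT THE SOCKET `lag_of_quotLeg`** — ★ `exists_comp_eq_iff_of_descent` instantiated at `A := A_x̄` (as an abelian variety), `B := 𝒞_{x̄₁}`, `r := ψ`, `n := p^1`
(the leg's (SIM) row with `[p] = [p^1]`): the realised kernel `κ : K ↪ G′` of `j′ ≫ ψ` is LAGRANGIAN for the cut duality `e` in ★ (BLK)'s points form.  Own declaration for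
the heartbeat budget. [cite: MumfordAV1970, §23 Thm. 2 (p. 231)] [cite: Tate1997FiniteFlatGroupSchemes, §(3.8) pp. 145–146] -/
theorem lag_of_quotLeg (I : RGDInputsAt F ι₁ Jstar K₀ S hU7ₛ hJ hJu Fi Kc G 𝓜 w hw h𝓨 θ e) [ExpChar (geomResidueField w) I.pChar]
    [IsCommMonObj I.univ.X]
    {m : ℕ} (E' : Matrix (Fin m) (Fin m) (𝓞 F)) (hE' : E' * E' = E')
    (xbar : AlgPoints (𝓜.localise w).reductionAt (geomResidueField w))
    (G' : SchemeOver (geomResidueField w)) [GrpObj G'] [IsCommMonObj G'] [IsAffine G'.left]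
    [Module.Free (geomResidueField w) (Alg G')] [Module.Finite (geomResidueField w) (Alg G')]
    (j' : G' ⟶ (sch₀Of 𝓜 w I.univ xbar).toAffine.toAbelianVariety.X) (e𝒟 : G' ≅ cartierDual G')
    (hpair : ∀ ⦃T : Type⦄ [CommRing T] [Algebra (geomResidueField w) T] [Module.Finite (geomResidueField w) T]
      (t s : specOver (geomResidueField w) T ⟶ G')
      (ht : ((t ≫ j') ≫ (pol₀Of 𝓜 w I.univ I.pol xbar).lam) ^ (I.pChar ^ 1) = 1) (hs : (s ≫ j') ^ (I.pChar ^ 1) = 1),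
      cartierPairing G' (t ≫ e𝒟.hom) s =
        (dual₀Of 𝓜 w I.univ I.dual xbar).weilChar (pol₀Of 𝓜 w I.univ I.pol xbar).nonempty_unitHatSlice_iso (I.pChar ^ 1)
          ((t ≫ j') ≫ (pol₀Of 𝓜 w I.univ I.pol xbar).lam) ht (s ≫ j') hs)
    (hG'p : ∀ ⦃T : SchemeOver (geomResidueField w)⦄ (t : T ⟶ G'), (t ≫ j') ^ (I.pChar ^ 1) = 1)
    (xbar₁ : AlgPoints (𝓜.localise w).reductionAt (geomResidueField w))
    (ψ₁ : (sch₀Of 𝓜 w I.univ xbar).X ⟶ (sch₀Of 𝓜 w (serreTensor I.act E' hE') xbar₁).X) [IsMonHom ψ₁]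
    (DB₁ : (sch₀Of 𝓜 w (serreTensor I.act E' hE') xbar₁).DualPair)
    (hDB₁ : Nonempty ((Scheme.Modules.pullback (DualPair.unitHatSlice DB₁)).obj DB₁.P ≅ SheafOfModules.unit _))
    (lamB₁ : (sch₀Of 𝓜 w (serreTensor I.act E' hE') xbar₁).X ⟶ DB₁.hat.X) [IsMonHom lamB₁]
    (hSIM₁ : ψ₁ ≫ lamB₁ ≫ DualPair.dualIsogenyOver ψ₁ (dual₀Of 𝓜 w I.univ I.dual xbar) DB₁ =
      (pol₀Of 𝓜 w I.univ I.pol xbar).lam ≫ (dual₀Of 𝓜 w I.univ I.dual xbar).hat.mulN I.pChar)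
    (K₁ : SchemeOver (geomResidueField w)) [GrpObj K₁] [IsCommMonObj K₁] [IsAffine K₁.left]
    [Module.Free (geomResidueField w) (Alg K₁)] [Module.Finite (geomResidueField w) (Alg K₁)]
    (κ₁ : K₁ ⟶ G') [IsMonHom κ₁] [IsClosedImmersion κ₁.left]
    (hκkill : (κ₁ ≫ j') ≫ ψ₁ = 1)
    (hrk : Module.finrank (geomResidueField w) (Alg G') = Module.finrank (geomResidueField w) (Alg K₁) * Module.finrank (geomResidueField w) (Alg K₁))
    ⦃T : SchemeOver (geomResidueField w)⦄ (t : T ⟶ G') :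
    (∃ s : T ⟶ K₁, s ≫ κ₁ = t) ↔ (t ≫ e𝒟.hom) ≫ cartierDualMap κ₁ = 1 := by
  have hp : I.pChar.Prime := I.hpChar.1
  haveI : Fact I.pChar.Prime := ⟨hp⟩
  have hp1 : I.pChar ^ 1 ≠ 0 := by rw [pow_one]; exact hp.ne_zero
  have hSIM₁' : ψ₁ ≫ lamB₁ ≫ DualPair.dualIsogenyOver (A' := (AbelianScheme.ofAbelianVariety (sch₀Of 𝓜 w I.univ xbar).toAffine.toAbelianVariety).toOver)
      (B := (AbelianScheme.ofAbelianVariety (sch₀Of 𝓜 w (serreTensor I.act E' hE') xbar₁).toAffine.toAbelianVariety).toOver) ψ₁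
        (dual₀Of 𝓜 w I.univ I.dual xbar) DB₁ =
      (pol₀Of 𝓜 w I.univ I.pol xbar).lam ≫ (dual₀Of 𝓜 w I.univ I.dual xbar).hat.mulN (I.pChar ^ 1) := by rw [pow_one]; exact hSIM₁
  exact DualPair.exists_comp_eq_iff_of_descent (I.pChar ^ 1) (sch₀Of 𝓜 w I.univ xbar).toAffine.toAbelianVariety (dual₀Of 𝓜 w I.univ I.dual xbar)
    (pol₀Of 𝓜 w I.univ I.pol xbar).nonempty_unitHatSlice_iso (pol₀Of 𝓜 w I.univ I.pol xbar)
    (sch₀Of 𝓜 w (serreTensor I.act E' hE') xbar₁).toAffine.toAbelianVariety DB₁ hDB₁ lamB₁ ψ₁ G' j' e𝒟 K₁ κ₁ hp1 hSIM₁' hG'p hpair hκkill hrk t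

set_option maxHeartbeats 400000 in
/-- **(s-FIX) `dockPt_of_fixed`** — the `ε_V = β(e_{c•w})`-FIXED points of the cut `G′ = A_x̄[𝔭_w𝔭_{c•w}]` are `𝔭_{c•w}`-torsion, hence points of the `c•w`-dock: for
`t ≫ εV = t`, `(t ≫ j′) ≫ ι(r) = (t ≫ j′) ≫ ι(r·e_{c•w}) = 1` for `r ∈ 𝔭_{c•w}` (`r·e_{c•w} ∈ 𝔭_w𝔭_{c•w}` by `e_{c•w} ∈ 𝔭_w`, ★ ED. 4
`exists_blockIdempotents_mem`), then `(𝔡 x̄).hkerG₀`. [cite: Tate1997FiniteFlatGroupSchemes, (3.7)] [cite: Tate1967, §2.2] -/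
theorem dockPt_of_fixed (I : RGDInputsAt F ι₁ Jstar K₀ S hU7ₛ hJ hJu Fi Kc G 𝓜 w hw h𝓨 θ e) [ExpChar (geomResidueField w) I.pChar]
    [IsCommMonObj I.univ.X]
    (𝔡 : ∀ xbar, DockAt I xbar) (xbar : AlgPoints (𝓜.localise w).reductionAt (geomResidueField w))
    (ecw : 𝓞 F) (hecw𝔭 : ecw ∈ w.asIdeal)
    (G' : SchemeOver (geomResidueField w)) [GrpObj G']
    (j' : G' ⟶ (sch₀Of 𝓜 w I.univ xbar).toAffine.toAbelianVariety.X) (εV : G' ⟶ G')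
    (hj' : ∀ ⦃T : SchemeOver (geomResidueField w)⦄ (t : T ⟶ (sch₀Of 𝓜 w I.univ xbar).toAffine.toAbelianVariety.X),
      (∃ s : T ⟶ G', s ≫ j' = t) ↔ ∀ a ∈ w.asIdeal * ((IsCMField.complexConj F) • w).asIdeal, t ≫ (act₀Of 𝓜 w I.univ I.act a xbar).hom.hom.hom = 1)
    (hεVj : εV ≫ j' = j' ≫ (act₀Of 𝓜 w I.univ I.act ecw xbar).hom.hom.hom)
    ⦃T : SchemeOver (geomResidueField w)⦄ (t : T ⟶ G') (ht : t ≫ εV = t) :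
    letI := (𝔡 xbar).grp₀
    ∃ s : T ⟶ (𝔡 xbar).G₀, s ≫ (𝔡 xbar).ι₀G = t ≫ j' := by
  letI := (𝔡 xbar).grp₀
  let ρ₀ : (sch₀Of 𝓜 w I.univ xbar).RingAction (𝓞 F) :=
    (I.act.baseChange (pullback.fst (𝓜.localise w).total.hom (specResidueField w))).baseChange xbar.left
  have hact : ∀ a, (act₀Of 𝓜 w I.univ I.act a xbar).hom.hom.hom = ρ₀.i a := fun a => rfl
  refine ((𝔡 xbar).hkerG₀ (t ≫ j')).1 fun r hr => ?_
  have hmem : r * ecw ∈ w.asIdeal * ((IsCMField.complexConj F) • w).asIdeal := by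
    rw [mul_comm r ecw]
    exact Ideal.mul_mem_mul hecw𝔭 hr
  have h := (hj' (t ≫ j')).1 ⟨t, rfl⟩ (r * ecw) hmem
  rw [hact, ρ₀.comp_i_mul] at h
  change ((t ≫ j') ≫ (act₀Of 𝓜 w I.univ I.act ecw xbar).hom.hom.hom) ≫ ρ₀.i r = 1 at h
  rw [Category.assoc t j', ← hεVj, ← Category.assoc, ht] at h
  exact h

set_option maxHeartbeats 400000 in
/-- **(s-REAL) READ ON `A_x̄` `real_comp_of_quotLeg`** — if `κ : K ↪ G′` realises `Ker (j′ ≫ ψ)` inside the cut and `Ker ψ ⊆ A_x̄[𝔭_w𝔭_{c•w}]` (K2), then `κ ≫ j′ : K ↪ A_x̄`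
realises `Ker ψ` (the premiss shape of the by-value rank rows (RK)). [cite: GortzWedhorn2020, Definition 4.45 (2) (p. 117)] -/
theorem real_comp_of_quotLeg (I : RGDInputsAt F ι₁ Jstar K₀ S hU7ₛ hJ hJu Fi Kc G 𝓜 w hw h𝓨 θ e) [ExpChar (geomResidueField w) I.pChar]
    [IsCommMonObj I.univ.X]
    {m : ℕ} (E' : Matrix (Fin m) (Fin m) (𝓞 F)) (hE' : E' * E' = E')
    (xbar : AlgPoints (𝓜.localise w).reductionAt (geomResidueField w))
    (G' : SchemeOver (geomResidueField w)) (j' : G' ⟶ (sch₀Of 𝓜 w I.univ xbar).toAffine.toAbelianVariety.X)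
    (hj' : ∀ ⦃T : SchemeOver (geomResidueField w)⦄ (t : T ⟶ (sch₀Of 𝓜 w I.univ xbar).toAffine.toAbelianVariety.X),
      (∃ s : T ⟶ G', s ≫ j' = t) ↔ ∀ a ∈ w.asIdeal * ((IsCMField.complexConj F) • w).asIdeal, t ≫ (act₀Of 𝓜 w I.univ I.act a xbar).hom.hom.hom = 1)
    (xbar₁ : AlgPoints (𝓜.localise w).reductionAt (geomResidueField w))
    (ψ₁ : (sch₀Of 𝓜 w I.univ xbar).X ⟶ (sch₀Of 𝓜 w (serreTensor I.act E' hE') xbar₁).X) [IsMonHom ψ₁]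
    (hK₁ : ∀ ⦃T : SchemeOver (geomResidueField w)⦄ (t : T ⟶ (sch₀Of 𝓜 w I.univ xbar).X), t ≫ ψ₁ = 1 →
      ∀ a ∈ w.asIdeal * ((IsCMField.complexConj F) • w).asIdeal, t ≫ (act₀Of 𝓜 w I.univ I.act a xbar).hom.hom.hom = 1)
    (K₁ : SchemeOver (geomResidueField w)) (κ₁ : K₁ ⟶ G')
    (hκ₁' : ∀ ⦃T : SchemeOver (geomResidueField w)⦄ (t : T ⟶ G'), (∃ s : T ⟶ K₁, s ≫ κ₁ = t) ↔ (t ≫ j') ≫ ψ₁ = 1)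
    ⦃T : SchemeOver (geomResidueField w)⦄ (t : T ⟶ (sch₀Of 𝓜 w I.univ xbar).X) :
    (∃ s : T ⟶ K₁, s ≫ (κ₁ ≫ j') = t) ↔ t ≫ ψ₁ = 1 := by
  constructor
  · rintro ⟨s, rfl⟩
    simpa only [Category.assoc] using (hκ₁' (s ≫ κ₁)).1 ⟨s, rfl⟩
  · intro ht
    obtain ⟨t', rfl⟩ := (hj' t).2 (hK₁ t ht)
    obtain ⟨s, hs⟩ := (hκ₁' t').2 ht
    exact ⟨s, by rw [← Category.assoc, hs]⟩

set_option maxHeartbeats 400000 in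
/-- **(C6′)-OF-CUT, ONE LEG `comp_eq_one_iff_of_two_quotLegs_of_cut_aux`** — rows (8)–(11) of the fold below for ONE reduced leg `ψ₁ : A_x̄ → 𝒞_{x̄₁″}`,
∃-packaged with its instance block (shape of ★ `exists_interLayer`): the kernel `K₁ := Ker (j′ ≫ ψ₁) ↪ G′` realised inside the cut ((s-REAL) ★ `exists_interLayer`,
read on `A_x̄` by `real_comp_of_quotLeg` for the rank row `hrk₁`), its points clause, (s-LAG) `K₁` LAGRANGIAN for `e` (`lag_of_quotLeg`, rank `q⁴ = q²·q²` by value from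
`hrkG′`∕`hrk₁`), and (C6′-stab) `K₁` is `ε_V`-STABLE (`exists_comp_eq_comp_of_equivariant` at `e_{c•w}`, from `hεVj`∕`hACT₁`).  Hoisted out of
`comp_eq_one_iff_of_two_quotLegs_of_cut` (which applies it once per leg) so that every declaration stays ≤ 400 000 heartbeats after the rung-E re-home of
its import cone; the statement of `comp_eq_one_iff_of_two_quotLegs_of_cut` is unchanged. [cite: MumfordAV1970, §23 Thm. 2 (p. 231)]
[cite: Tate1997FiniteFlatGroupSchemes, §(3.8) pp. 145–146] [cite: Liu2021, Prop. D.8 p. 135, p. 137] -/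
theorem comp_eq_one_iff_of_two_quotLegs_of_cut_aux (I : RGDInputsAt F ι₁ Jstar K₀ S hU7ₛ hJ hJu Fi Kc G 𝓜 w hw h𝓨 θ e) [ExpChar (geomResidueField w) I.pChar]
    [IsCommMonObj I.univ.X]
    {m : ℕ} (E' : Matrix (Fin m) (Fin m) (𝓞 F)) (hE' : E' * E' = E')
    (xbar : AlgPoints (𝓜.localise w).reductionAt (geomResidueField w))
    (ecw : 𝓞 F)
    (G' : SchemeOver (geomResidueField w)) [GrpObj G'] [IsCommMonObj G'] [IsAffine G'.left]
    [Module.Free (geomResidueField w) (Alg G')] [Module.Finite (geomResidueField w) (Alg G')]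
    (j' : G' ⟶ (sch₀Of 𝓜 w I.univ xbar).toAffine.toAbelianVariety.X) [IsMonHom j'] [IsClosedImmersion j'.left]
    (e𝒟 : G' ≅ cartierDual G') (εV : G' ⟶ G')
    (hj' : ∀ ⦃T : SchemeOver (geomResidueField w)⦄ (t : T ⟶ (sch₀Of 𝓜 w I.univ xbar).toAffine.toAbelianVariety.X),
      (∃ s : T ⟶ G', s ≫ j' = t) ↔ ∀ a ∈ w.asIdeal * ((IsCMField.complexConj F) • w).asIdeal, t ≫ (act₀Of 𝓜 w I.univ I.act a xbar).hom.hom.hom = 1)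
    (hεVj : εV ≫ j' = j' ≫ (act₀Of 𝓜 w I.univ I.act ecw xbar).hom.hom.hom)
    (hpair : ∀ ⦃T : Type⦄ [CommRing T] [Algebra (geomResidueField w) T] [Module.Finite (geomResidueField w) T]
      (t s : specOver (geomResidueField w) T ⟶ G')
      (ht : ((t ≫ j') ≫ (pol₀Of 𝓜 w I.univ I.pol xbar).lam) ^ (I.pChar ^ 1) = 1) (hs : (s ≫ j') ^ (I.pChar ^ 1) = 1),
      cartierPairing G' (t ≫ e𝒟.hom) s =
        (dual₀Of 𝓜 w I.univ I.dual xbar).weilChar (pol₀Of 𝓜 w I.univ I.pol xbar).nonempty_unitHatSlice_iso (I.pChar ^ 1)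
          ((t ≫ j') ≫ (pol₀Of 𝓜 w I.univ I.pol xbar).lam) ht (s ≫ j') hs)
    (hG'p : ∀ ⦃T : SchemeOver (geomResidueField w)⦄ (t : T ⟶ G'), (t ≫ j') ^ (I.pChar ^ 1) = 1)
    (hrkG' : Module.finrank (geomResidueField w) (Alg G') = (I.pChar ^ I.fDeg * I.pChar ^ I.fDeg) * (I.pChar ^ I.fDeg * I.pChar ^ I.fDeg))
    (xbar₁ : AlgPoints (𝓜.localise w).reductionAt (geomResidueField w))
    (ψ₁ : (sch₀Of 𝓜 w I.univ xbar).X ⟶ (sch₀Of 𝓜 w (serreTensor I.act E' hE') xbar₁).X) [IsMonHom ψ₁]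
    (DB₁ : (sch₀Of 𝓜 w (serreTensor I.act E' hE') xbar₁).DualPair)
    (hDB₁ : Nonempty ((Scheme.Modules.pullback (DualPair.unitHatSlice DB₁)).obj DB₁.P ≅ SheafOfModules.unit _))
    (lamB₁ : (sch₀Of 𝓜 w (serreTensor I.act E' hE') xbar₁).X ⟶ DB₁.hat.X) [IsMonHom lamB₁]
    (hSIM₁ : ψ₁ ≫ lamB₁ ≫ DualPair.dualIsogenyOver ψ₁ (dual₀Of 𝓜 w I.univ I.dual xbar) DB₁ =
      (pol₀Of 𝓜 w I.univ I.pol xbar).lam ≫ (dual₀Of 𝓜 w I.univ I.dual xbar).hat.mulN I.pChar)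
    (hACT₁ : (act₀Of 𝓜 w I.univ I.act ecw xbar).hom.hom.hom ≫ ψ₁ =
      ψ₁ ≫ (act₀Of 𝓜 w (serreTensor I.act E' hE') (serreAction I.act E' hE') ecw xbar₁).hom.hom.hom)
    (hK₁ : ∀ ⦃T : SchemeOver (geomResidueField w)⦄ (t : T ⟶ (sch₀Of 𝓜 w I.univ xbar).X), t ≫ ψ₁ = 1 →
      ∀ a ∈ w.asIdeal * ((IsCMField.complexConj F) • w).asIdeal, t ≫ (act₀Of 𝓜 w I.univ I.act a xbar).hom.hom.hom = 1)
    (hrk₁ : ∀ (K : SchemeOver (geomResidueField w)) [GrpObj K] [IsAffine K.left] [Module.Finite (geomResidueField w) (Alg K)]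
      (κ : K ⟶ (sch₀Of 𝓜 w I.univ xbar).X) [IsMonHom κ] [IsClosedImmersion κ.left],
      (∀ ⦃T : SchemeOver (geomResidueField w)⦄ (t : T ⟶ (sch₀Of 𝓜 w I.univ xbar).X), (∃ s : T ⟶ K, s ≫ κ = t) ↔ t ≫ ψ₁ = 1) →
      Module.finrank (geomResidueField w) (Alg K) = I.pChar ^ I.fDeg * I.pChar ^ I.fDeg) :
    ∃ (K₁ : SchemeOver (geomResidueField w)) (_ : GrpObj K₁) (_ : IsCommMonObj K₁) (_ : IsAffine K₁.left)
      (_ : Module.Free (geomResidueField w) (Alg K₁)) (_ : Module.Finite (geomResidueField w) (Alg K₁))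
      (κ₁ : K₁ ⟶ G') (_ : IsMonHom κ₁) (_ : Mono κ₁),
      (∀ ⦃T : SchemeOver (geomResidueField w)⦄ (t : T ⟶ G'), (∃ s : T ⟶ K₁, s ≫ κ₁ = t) ↔ (t ≫ j') ≫ ψ₁ = 1) ∧
      (∀ ⦃T : SchemeOver (geomResidueField w)⦄ (t : T ⟶ G'), (∃ s : T ⟶ K₁, s ≫ κ₁ = t) ↔ (t ≫ e𝒟.hom) ≫ cartierDualMap κ₁ = 1) ∧
      (∀ ⦃T : SchemeOver (geomResidueField w)⦄ (t : T ⟶ G'), (∃ s : T ⟶ K₁, s ≫ κ₁ = t) → ∃ s : T ⟶ K₁, s ≫ κ₁ = t ≫ εV) := by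
  let A₀ : AbelianSchemeOver (Spec (.of (geomResidueField w))) := sch₀Of 𝓜 w I.univ xbar
  let Av : AbelianVariety (geomResidueField w) := A₀.toAffine.toAbelianVariety
  let act : 𝓞 F → (Av ⟶ Av) := fun a => act₀Of 𝓜 w I.univ I.act a xbar
  -- ===================== (8) (s-REAL): `K₁ := Ker (j′ ≫ ψ₁) ↪ G′` (★ `exists_interLayer`) =====================
  haveI : IsProper (sch₀Of 𝓜 w (serreTensor I.act E' hE') xbar₁).X.hom := (sch₀Of 𝓜 w (serreTensor I.act E' hE') xbar₁).isProper
  obtain ⟨K₁, k11, k12, k13, k14, k15, κ₁, hκ₁m, hκ₁ci, hκ₁⟩ := exists_interLayer G' (j' ≫ ψ₁)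
  haveI := hκ₁m; haveI := hκ₁ci
  haveI hκ₁mono : Mono κ₁ := Over.mono_of_mono_left κ₁
  have hκ₁' : ∀ ⦃T : SchemeOver (geomResidueField w)⦄ (t : T ⟶ G'), (∃ s : T ⟶ K₁, s ≫ κ₁ = t) ↔ (t ≫ j') ≫ ψ₁ = 1 := fun T t => by
    rw [hκ₁ t, Category.assoc]
  -- the composite realisation `κ₁ ≫ j′ : K₁ ↪ A_x̄` of `Ker ψ₁` (for the rank row)
  have hreal₁ := real_comp_of_quotLeg I E' hE' xbar G' j' hj' xbar₁ ψ₁ hK₁ K₁ κ₁ hκ₁'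
  -- ===================== (9) THE RANK ROW `rk G′ = rk K₁ · rk K₁` (by value) =====================
  haveI : IsClosedImmersion (κ₁ ≫ j').left := by rw [Over.comp_left]; infer_instance
  have hrkK₁ : Module.finrank (geomResidueField w) (Alg K₁) = I.pChar ^ I.fDeg * I.pChar ^ I.fDeg := hrk₁ K₁ (κ₁ ≫ j') hreal₁
  -- ===================== (10) (s-LAG): `K₁` IS LAGRANGIAN FOR `e` (★ `exists_comp_eq_iff_of_descent`) =====================
  have hlag₁ : ∀ ⦃T : SchemeOver (geomResidueField w)⦄ (t : T ⟶ G'), (∃ s : T ⟶ K₁, s ≫ κ₁ = t) ↔ (t ≫ e𝒟.hom) ≫ cartierDualMap κ₁ = 1 :=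
    lag_of_quotLeg I E' hE' xbar G' j' e𝒟 hpair hG'p xbar₁ ψ₁ DB₁ hDB₁ lamB₁ hSIM₁ K₁ κ₁ ((hκ₁' κ₁).1 ⟨𝟙 _, Category.id_comp _⟩) (by rw [hrkG', hrkK₁])
  -- ===================== (11) `ε_V`-STABILITY of `K₁` ((C6′-stab), ACT at `e_{c•w}`) =====================
  have hV₁ := Literature.AlgebraicGeometry.GroupSchemes.AffineGroupScheme.exists_comp_eq_comp_of_equivariant G' j' εV K₁ κ₁ ψ₁ (fun a => (act a).hom.hom.hom)
    (fun a => (act₀Of 𝓜 w (serreTensor I.act E' hE') (serreAction I.act E' hE') a xbar₁).hom.hom.hom) ecw hεVj hACT₁ hκ₁'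
  exact ⟨K₁, k11, k12, k13, k14, k15, κ₁, hκ₁m, hκ₁mono, hκ₁', hlag₁, hV₁⟩

end QuotWDFold

end Block_I

end Summit.HodgeConjecture.HodgeConjecture.Cruxes.HLiu418.F0P6aLineSpecialisation

end
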